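import Summits.QuantumFields.QCD.Theses.SpectralDefectExtinction
import Summits.QuantumFields.QCD.Theorems.ExtinctionBuildsQCD.Negative.WithoutTightCollapse
import Summits.QuantumFields.QCD.Theorems.WindowExtinction.Negative.SpectralFlowLocal
import Literature.MathematicalPhysics.QuantumFieldTheory.QCDPhaseQuenched
import Literature.MathematicalPhysics.QuantumFieldTheory.SpectralDefectDensity
import Literature.LinearAlgebra.Matrix.HermitianEigenvaluePerturbation
import Mathlib.LinearAlgebra.Matrix.Charpoly.Eigs
import Mathlib.LinearAlgebra.Matrix.ToLinearEquiv
import Mathlib.Analysis.Complex.Polynomial.Basic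
import Mathlib.Topology.Ultrafilter

/-!
# Stub `stub_countMeasurable` of line `hermitian-flow-coarea`
(crux `Summit.QuantumFields.QCD.Theses.SpectralDefectExtinction.TipPricing`, item stmt-QuantumFields-8967)

Borel measurability of the two spectral counts the line integrates against the Wilson measure
(the named `Prop` `CountMeasurable` of the skeleton; without it the Bochner integrals of the
coarea lift would be junk):

* (i) `(U, t) ↦ N_U(t, η) := #{eigenvalues of H_U(t) = Γ₅ D_W(U, −t, 1) with |re| < η}`
  (with algebraic multiplicity, as `Multiset.countP` over the roots of the characteristic
  polynomial) is measurable on `GaugeConfig 4 L SU3 × ℝ`;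
* (ii) `U ↦ #{roots z of charpoly D_W(U, 0, 1) with im z = 0, t₁ < re z < t₂}` is measurable on
  `GaugeConfig 4 L SU3`.

Both are instances of ONE general statement, `countMeas_measurable_countP`: for a continuous
matrix-valued map `A` on a topological space whose σ-algebra contains the open sets and a predicate
`P` on `ℂ` whose truth set is an increasing countable union of CLOSED sets `F j`, the count
`x ↦ (charpoly (A x)).roots.countP P` is measurable.  Route:

1. `countMeas_isClosed_setOf_le_countP` — for closed `F` the superlevel set
   `{x | m ≤ #(roots of charpoly (A x) in F)}` is closed (upper semicontinuity of the count;
   "continuity of the roots of a monic polynomial in its coefficients").  Along an ultrafilter `u`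
   converging to `x` and containing the superlevel set: the root tuples
   `z(x') : Fin (card n) → ℂ` (`charpoly (A x') = ∏ᵢ (X − z(x')ᵢ)`, `ℂ` algebraically closed) are
   bounded by the entry sum `∑ ‖A x' a b‖` (`countMeas_norm_le_of_isRoot_charpoly`, an eigenvector
   row-sum estimate), hence converge along `u` to a tuple `w` (compactness of closed balls in
   `Fin N → ℂ`); the finite index set `{i | z(x')ᵢ ∈ F}` is `u`-eventually a constant `I₀` with
   `m ≤ |I₀|`, so `wᵢ ∈ F` for `i ∈ I₀` (`F` closed); and `charpoly (A x) = ∏ᵢ (X − wᵢ)` since both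
   sides take the same value at every `c ∈ ℂ` (the `u`-limits of
   `det (c − A x') = ∏ᵢ (c − z(x')ᵢ)`; `Polynomial.funext`).  Hence the count at `x` is
   `≥ |I₀| ≥ m`.
2. `countMeas_le_countP_iff` — over a finite multiset, `m ≤ countP P ↔ ∃ j, m ≤ countP (· ∈ F j)`,
   so the superlevel sets of the `P`-count are countable unions of closed sets, and an `ℕ`-valued
   map with measurable superlevel sets is measurable (`countMeas_measurable_of_superlevel`).
3. The two applications: continuity of `U ↦ D_W(U, 0, 1)` (`continuous_wilsonDirac`) and of
   `(U, t) ↦ Γ₅ (D_W(U, 0, 1) − t)` (`wilsonDirac_mass_eq_add_scalar`); the exhaustions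
   `{|re| ≤ η − 1/(j+1)}` of `{|re| < η}` and `{im = 0, t₁ + 1/(j+1) ≤ re ≤ t₂ − 1/(j+1)}` of
   `{im = 0, t₁ < re < t₂}`.

No new definitions; pure theorem file serving the lead's skeleton `work/TipPricing.lean`
(Mathlib only: `Matrix.eval_charpoly`, `Matrix.exists_mulVec_eq_zero_iff`, `IsAlgClosed.splits`,
`Polynomial.roots_multiset_prod_X_sub_C`, `isClosed_iff_ultrafilter`,
`IsCompact.ultrafilter_le_nhds`, `Ultrafilter.eventually_exists_iff`).
-/

noncomputable section

namespace Summit.QuantumFields.QCD.Cruxes.TipPricing.HermitianFlowCoarea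

open scoped BigOperators Topology Classical MeasureTheory Matrix ComplexConjugate
open Filter MeasureTheory
open Literature.MathematicalPhysics.QuantumLattice Literature.MathematicalPhysics.QuantumFieldTheory
  Literature.Probability.LatticeModels
open Summit.QuantumFields.QCD.Theses.SpectralDefectExtinction

/-! ## The general fact: semicontinuity and measurability of root counts -/

section General

open Polynomial

variable {n : Type*} [Fintype n] [DecidableEq n]

/-- A multiset of cardinality `N` is the image of `Finset.univ : Finset (Fin N)` under a tuple. -/
theorem countMeas_exists_tuple_of_card_eq {α : Type*} {N : ℕ} (s : Multiset α)
    (hs : Multiset.card s = N) :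
    ∃ f : Fin N → α, (Finset.univ : Finset (Fin N)).val.map f = s := by
  subst hs
  induction s using Quotient.inductionOn with
  | h l =>
    refine ⟨fun i => l.get i, ?_⟩
    rw [Fin.univ_val_map]
    exact congrArg _ (List.ofFn_get l)

/-- The number of roots in `F` of `∏ i, (X - C (w i))` is the number of indices `i` with
`w i ∈ F`. -/
theorem countMeas_countP_roots_prod {N : ℕ} (w : Fin N → ℂ) (F : Set ℂ) :
    (∏ i, (X - C (w i))).roots.countP (· ∈ F) =
      (Finset.univ.filter fun i => w i ∈ F).card := by
  have h : (∏ i, (X - C (w i))) = ((Finset.univ.val.map w).map fun a => X - C a).prod := by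
    rw [Multiset.map_map, Finset.prod_eq_multiset_prod]
    rfl
  rw [h, roots_multiset_prod_X_sub_C, Multiset.countP_map]
  rfl

/-- Over `ℂ` the characteristic polynomial of an `n × n` matrix is a product of `card n` linear
factors, indexed by `Fin (card n)`. -/
theorem countMeas_exists_charpoly_eq_prod (M : Matrix n n ℂ) :
    ∃ z : Fin (Fintype.card n) → ℂ, M.charpoly = ∏ i, (X - C (z i)) := by
  have hsplit : M.charpoly.Splits := IsAlgClosed.splits M.charpoly
  have hcard : Multiset.card M.charpoly.roots = Fintype.card n := by
    rw [← Matrix.charpoly_natDegree_eq_dim M, hsplit.natDegree_eq_card_roots]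
  obtain ⟨z, hz⟩ := countMeas_exists_tuple_of_card_eq _ hcard
  refine ⟨z, ?_⟩
  have h : (∏ i, (X - C (z i))) = ((Finset.univ.val.map z).map fun a => X - C a).prod := by
    rw [Multiset.map_map, Finset.prod_eq_multiset_prod]
    rfl
  rw [h, hz]
  exact hsplit.eq_prod_roots_of_monic (Matrix.charpoly_monic M)

/-- **Row-sum bound on the eigenvalues.** Every root `μ` of the characteristic polynomial of a
complex matrix `M` satisfies `‖μ‖ ≤ ∑ i j, ‖M i j‖` (an eigenvector `v` with `Mv = μv` gives
`|μ| ‖v‖_∞ ≤ (max row sum) ‖v‖_∞`). -/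
theorem countMeas_norm_le_of_isRoot_charpoly (M : Matrix n n ℂ) {μ : ℂ}
    (h : M.charpoly.IsRoot μ) : ‖μ‖ ≤ ∑ i, ∑ j, ‖M i j‖ := by
  have hdet : (Matrix.scalar n μ - M).det = 0 := by
    rw [← Matrix.eval_charpoly]
    exact h
  obtain ⟨v, hv0, hv⟩ := Matrix.exists_mulVec_eq_zero_iff.mpr hdet
  obtain ⟨i₁, hi₁⟩ : ∃ i, v i ≠ 0 := by
    by_contra hall
    push Not at hall
    exact hv0 (funext hall)
  obtain ⟨i₀, -, hi₀⟩ :=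
    Finset.exists_max_image Finset.univ (fun i => ‖v i‖) ⟨i₁, Finset.mem_univ i₁⟩
  have hpos : 0 < ‖v i₀‖ := (norm_pos_iff.mpr hi₁).trans_le (hi₀ i₁ (Finset.mem_univ i₁))
  have hrow : μ * v i₀ = (M *ᵥ v) i₀ := by
    have := congrFun hv i₀
    rwa [Matrix.sub_mulVec, Pi.sub_apply, Pi.zero_apply, Matrix.scalar_apply,
      Matrix.mulVec_diagonal, sub_eq_zero] at this
  have key : ‖μ‖ * ‖v i₀‖ ≤ (∑ j, ‖M i₀ j‖) * ‖v i₀‖ := by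
    calc ‖μ‖ * ‖v i₀‖ = ‖(M *ᵥ v) i₀‖ := by rw [← norm_mul, hrow]
      _ = ‖∑ j, M i₀ j * v j‖ := rfl
      _ ≤ ∑ j, ‖M i₀ j * v j‖ := norm_sum_le _ _
      _ ≤ ∑ j, ‖M i₀ j‖ * ‖v i₀‖ := Finset.sum_le_sum fun j _ => by
          rw [norm_mul]
          exact mul_le_mul_of_nonneg_left (hi₀ j (Finset.mem_univ j)) (norm_nonneg _)
      _ = (∑ j, ‖M i₀ j‖) * ‖v i₀‖ := (Finset.sum_mul _ _ _).symm
  have h1 : ‖μ‖ ≤ ∑ j, ‖M i₀ j‖ := le_of_mul_le_mul_right key hpos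
  exact h1.trans (Finset.single_le_sum (f := fun i => ∑ j, ‖M i j‖)
    (fun i _ => Finset.sum_nonneg fun j _ => norm_nonneg _) (Finset.mem_univ i₀))

/-- **Upper semicontinuity of the root count in a closed set.** For a continuous matrix-valued map
`A` on a topological space `T` and a closed `F ⊆ ℂ`, the set of `x` at which the characteristic
polynomial of `A x` has at least `m` roots in `F` (with multiplicity) is closed.  Proof: along an
ultrafilter converging to `x` the root tuples are bounded, hence converge along the ultrafilter to
a tuple `w`; the index set of roots in `F` is eventually constant (`= I₀`, `m ≤ |I₀|`), so
`w i ∈ F` for `i ∈ I₀`; and `charpoly (A x) = ∏ (X - w i)` because both sides have the same values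
(limits of `det (c - A x') = ∏ (c - z_i(x'))`). -/
theorem countMeas_isClosed_setOf_le_countP {T : Type*} [TopologicalSpace T]
    {A : T → Matrix n n ℂ} (hA : Continuous A) {F : Set ℂ} (hF : IsClosed F) (m : ℕ) :
    IsClosed {x | m ≤ (A x).charpoly.roots.countP (· ∈ F)} := by
  choose z hz using fun x => countMeas_exists_charpoly_eq_prod (A x)
  have hcount : ∀ x, (A x).charpoly.roots.countP (· ∈ F) =
      (Finset.univ.filter fun i => z x i ∈ F).card := fun x => by
    rw [hz x, countMeas_countP_roots_prod]
  have heval : ∀ x c, (A x).charpoly.eval c = ∏ i, (c - z x i) := fun x c => by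
    rw [hz x, eval_prod]
    simp only [eval_sub, eval_X, eval_C]
  have hbound : ∀ x i, ‖z x i‖ ≤ ∑ a, ∑ b, ‖A x a b‖ := fun x i => by
    refine countMeas_norm_le_of_isRoot_charpoly (A x) ?_
    rw [IsRoot, heval]
    exact Finset.prod_eq_zero (Finset.mem_univ i) (sub_self _)
  rw [isClosed_iff_ultrafilter]
  intro x u hux hxu
  -- the index set of the roots lying in `F` is constant along `u`
  obtain ⟨I₀, hI₀⟩ : ∃ I₀ : Finset (Fin (Fintype.card n)),
      ∀ᶠ x' in (u : Filter T), (Finset.univ.filter fun i => z x' i ∈ F) = I₀ :=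
    Ultrafilter.eventually_exists_iff.mp (Eventually.of_forall fun x' => ⟨_, rfl⟩)
  have hm : m ≤ I₀.card := by
    obtain ⟨x', h1, h2⟩ := (hI₀.and hxu).exists
    rw [← h1, ← hcount]
    exact h2
  -- the root tuples are bounded along `u`, hence converge along `u`
  set R : ℝ := (∑ a, ∑ b, ‖A x a b‖) + 1 with hR
  have hBcont : Continuous fun x' => ∑ a, ∑ b, ‖A x' a b‖ :=
    continuous_finsetSum _ fun a _ => continuous_finsetSum _ fun b _ => (hA.matrix_elem a b).norm
  have hR0 : 0 ≤ R := add_nonneg (Finset.sum_nonneg fun a _ => Finset.sum_nonneg fun b _ =>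
    norm_nonneg _) zero_le_one
  have hball : ∀ᶠ x' in (u : Filter T),
      z x' ∈ Metric.closedBall (0 : Fin (Fintype.card n) → ℂ) R := by
    have h1 : ∀ᶠ x' in 𝓝 x, (∑ a, ∑ b, ‖A x' a b‖) < R :=
      (hBcont.tendsto x).eventually (gt_mem_nhds (lt_add_one _))
    refine (h1.filter_mono hux).mono fun x' hx' => ?_
    rw [mem_closedBall_zero_iff]
    exact (pi_norm_le_iff_of_nonneg hR0).mpr fun i => (hbound x' i).trans hx'.le
  have hle : (u.map z : Filter (Fin (Fintype.card n) → ℂ)) ≤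
      𝓟 (Metric.closedBall (0 : Fin (Fintype.card n) → ℂ) R) := by
    rw [Ultrafilter.coe_map, le_principal_iff]
    exact hball
  obtain ⟨w, -, hw⟩ := (isCompact_closedBall _ R).ultrafilter_le_nhds (u.map z) hle
  have hzw : Tendsto z (u : Filter T) (𝓝 w) := by
    rw [Tendsto, ← Ultrafilter.coe_map]
    exact hw
  have hzwi : ∀ i, Tendsto (fun x' => z x' i) (u : Filter T) (𝓝 (w i)) := fun i =>
    ((continuous_apply i).tendsto w).comp hzw
  -- the limit tuple has its `I₀`-entries in `F`
  have hwF : ∀ i ∈ I₀, w i ∈ F := fun i hi =>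
    hF.mem_of_tendsto (hzwi i) (hI₀.mono fun x' hx' => by
      have : i ∈ Finset.univ.filter fun j => z x' j ∈ F := hx' ▸ hi
      exact (Finset.mem_filter.mp this).2)
  -- and it is a root tuple of `charpoly (A x)`
  have hlim : (A x).charpoly = ∏ i, (X - C (w i)) := by
    refine Polynomial.funext fun c => ?_
    have h1 : Tendsto (fun x' => (A x').charpoly.eval c) (u : Filter T)
        (𝓝 ((A x).charpoly.eval c)) := by
      simp_rw [Matrix.eval_charpoly]
      exact ((continuous_const.sub hA).matrix_det.tendsto x).mono_left hux
    have h2 : Tendsto (fun x' => (A x').charpoly.eval c) (u : Filter T)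
        (𝓝 (∏ i, (c - w i))) := by
      simp_rw [heval]
      exact tendsto_finsetProd _ fun i _ => tendsto_const_nhds.sub (hzwi i)
    rw [tendsto_nhds_unique h1 h2, eval_prod]
    simp only [eval_sub, eval_X, eval_C]
  show m ≤ _
  rw [hlim, countMeas_countP_roots_prod]
  exact hm.trans (Finset.card_le_card fun i hi =>
    Finset.mem_filter.mpr ⟨Finset.mem_univ _, hwF i hi⟩)

/-- An `ℕ`-valued function with measurable superlevel sets is measurable. -/
theorem countMeas_measurable_of_superlevel {T : Type*} [MeasurableSpace T] {f : T → ℕ}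
    (hf : ∀ m, MeasurableSet {x | m ≤ f x}) : Measurable f := by
  refine measurable_to_countable' fun m => ?_
  have : f ⁻¹' {m} = {x | m ≤ f x} \ {x | m + 1 ≤ f x} := by
    ext x
    simp only [Set.mem_preimage, Set.mem_singleton_iff, Set.mem_sdiff, Set.mem_setOf_eq]
    omega
  rw [this]
  exact (hf m).diff (hf (m + 1))

/-- Counting in an increasing countable union `{P} = ⋃ⱼ F j` over a (finite) multiset: at least
`m` elements satisfy `P` iff at least `m` elements lie in some `F j`. -/
theorem countMeas_le_countP_iff {α : Type*} (s : Multiset α) (P : α → Prop) [DecidablePred P]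
    (F : ℕ → Set α) (hmono : Monotone F) (hPF : ∀ a, P a ↔ ∃ j, a ∈ F j) (m : ℕ) :
    m ≤ s.countP P ↔ ∃ j, m ≤ s.countP (· ∈ F j) := by
  have hJ : ∃ J, ∀ a ∈ s, P a → a ∈ F J := by
    induction s using Multiset.induction_on with
    | empty => exact ⟨0, fun a ha _ => absurd ha (Multiset.notMem_zero a)⟩
    | cons b s ih =>
      obtain ⟨J₀, hJ₀⟩ := ih
      by_cases hb : P b
      · obtain ⟨j, hj⟩ := (hPF b).mp hb
        refine ⟨max J₀ j, fun a ha hPa => ?_⟩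
        rcases Multiset.mem_cons.mp ha with rfl | ha
        · exact hmono (le_max_right _ _) hj
        · exact hmono (le_max_left _ _) (hJ₀ a ha hPa)
      · refine ⟨J₀, fun a ha hPa => ?_⟩
        rcases Multiset.mem_cons.mp ha with rfl | ha
        · exact absurd hPa hb
        · exact hJ₀ a ha hPa
  obtain ⟨J, hJ⟩ := hJ
  constructor
  · intro hm
    exact ⟨J, hm.trans_eq (Multiset.countP_congr rfl fun a ha =>
      propext ⟨hJ a ha, fun h => (hPF a).mpr ⟨J, h⟩⟩)⟩
  · rintro ⟨j, hj⟩
    refine hj.trans ?_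
    rw [Multiset.countP_eq_card_filter, Multiset.countP_eq_card_filter]
    exact Multiset.card_le_card (Multiset.monotone_filter_right s fun a ha => (hPF a).mpr ⟨j, ha⟩)

/-- **Measurability of spectral counts.** For a continuous matrix-valued map `A` on a topological
space with a measurable structure containing the open sets, and a predicate `P` on `ℂ` whose truth
set is an increasing countable union of closed sets, `x ↦ #{roots of charpoly (A x) satisfying P}`
(with multiplicity) is measurable: its superlevel sets are countable unions of closed sets. -/
theorem countMeas_measurable_countP {T : Type*} [TopologicalSpace T] [MeasurableSpace T]
    [OpensMeasurableSpace T] {A : T → Matrix n n ℂ} (hA : Continuous A) (P : ℂ → Prop)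
    [DecidablePred P] (F : ℕ → Set ℂ) (hF : ∀ j, IsClosed (F j)) (hmono : Monotone F)
    (hPF : ∀ a, P a ↔ ∃ j, a ∈ F j) :
    Measurable fun x => (A x).charpoly.roots.countP P := by
  refine countMeas_measurable_of_superlevel fun m => ?_
  have : {x | m ≤ (A x).charpoly.roots.countP P} =
      ⋃ j, {x | m ≤ (A x).charpoly.roots.countP (· ∈ F j)} := by
    ext x
    simp only [Set.mem_setOf_eq, Set.mem_iUnion]
    exact countMeas_le_countP_iff _ P F hmono hPF m
  rw [this]
  exact MeasurableSet.iUnion fun j => (countMeas_isClosed_setOf_le_countP hA (hF j) m).measurableSet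

end General

/-! ## The two spectral counts of the line -/

/-- `1/(k+1) ≤ 1/(j+1)` for `j ≤ k` (monotonicity of the closed exhaustions below). -/
private theorem countMeas_one_div_succ_anti {j k : ℕ} (h : j ≤ k) :
    (1 : ℝ) / (k + 1) ≤ 1 / (j + 1) :=
  one_div_le_one_div_of_le (by positivity) (by exact_mod_cast Nat.succ_le_succ h)

/-- **STUB 2 · `stub_countMeasurable`** — Borel measurability of the zero-window level count
`(U,t) ↦ N_U(t,η)` of the Hermitian Wilson operator and of the real-root count `U ↦ #real(t₁,t₂)` of the
massless Wilson–Dirac operator. -/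
theorem stub_countMeasurable :
    (∀ (L : ℕ) [NeZero L] (η : ℝ), Measurable fun p : GaugeConfig 4 L SU3 × ℝ => Multiset.countP
      (fun z : ℂ => |z.re| < η) (spinorLift gammaFive * wilsonDirac (fundamentalRep (Fin 3)) p.1
      (-p.2) 1).charpoly.roots) ∧ (∀ (L : ℕ) [NeZero L] (t₁ t₂ : ℝ), Measurable fun U : GaugeConfig
      4 L SU3 => Multiset.countP (fun z : ℂ => z.im = 0 ∧ t₁ < z.re ∧ z.re < t₂) (wilsonDirac
      (fundamentalRep (Fin 3)) U 0 1).charpoly.roots) := by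
  have hρ := continuous_fundamentalRep (Fin 3)
  refine ⟨fun L _ η => ?_, fun L _ t₁ t₂ => ?_⟩
  · -- (i) the zero-window level count of `H_U(t) = Γ₅ D_W(U,-t,1)`, jointly in `(U,t)`
    have hA : Continuous fun p : GaugeConfig 4 L SU3 × ℝ =>
        spinorLift gammaFive * wilsonDirac (fundamentalRep (Fin 3)) p.1 (-p.2) 1 := by
      have h : (fun p : GaugeConfig 4 L SU3 × ℝ =>
          spinorLift gammaFive * wilsonDirac (fundamentalRep (Fin 3)) p.1 (-p.2) 1) =
          fun p => spinorLift gammaFive * (wilsonDirac (fundamentalRep (Fin 3)) p.1 0 1 +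
            Matrix.diagonal fun _ => (((-p.2 : ℝ)) : ℂ)) := by
        funext p
        rw [wilsonDirac_mass_eq_add_scalar, Matrix.scalar_apply]
      rw [h]
      refine continuous_const.matrix_mul
        (((continuous_wilsonDirac _ hρ 0 1).comp continuous_fst).add ?_)
      exact (continuous_pi fun _ =>
        Complex.continuous_ofReal.comp continuous_snd.neg).matrix_diagonal
    refine countMeas_measurable_countP hA (fun z : ℂ => |z.re| < η)
      (fun j => {z : ℂ | |z.re| ≤ η - 1 / (j + 1)}) (fun j => ?_) (fun j k hjk => ?_) (fun z => ?_)
    · exact isClosed_le (continuous_abs.comp Complex.continuous_re) continuous_const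
    · intro z hz
      simp only [Set.mem_setOf_eq] at hz ⊢
      linarith [countMeas_one_div_succ_anti hjk]
    · constructor
      · intro h
        obtain ⟨j, hj⟩ := exists_nat_one_div_lt (sub_pos.mpr h)
        exact ⟨j, by simp only [Set.mem_setOf_eq]; linarith⟩
      · rintro ⟨j, hj⟩
        simp only [Set.mem_setOf_eq] at hj
        have : (0 : ℝ) < 1 / (j + 1) := by positivity
        linarith
  · -- (ii) the real-root count of `D_W(U,0,1)` in the open interval `(t₁, t₂)`
    have hA : Continuous fun U : GaugeConfig 4 L SU3 =>
        wilsonDirac (fundamentalRep (Fin 3)) U 0 1 := continuous_wilsonDirac _ hρ 0 1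
    refine countMeas_measurable_countP hA (fun z : ℂ => z.im = 0 ∧ t₁ < z.re ∧ z.re < t₂)
      (fun j => {z : ℂ | z.im = 0 ∧ t₁ + 1 / (j + 1) ≤ z.re ∧ z.re ≤ t₂ - 1 / (j + 1)})
      (fun j => ?_) (fun j k hjk => ?_) (fun z => ?_)
    · exact (isClosed_eq Complex.continuous_im continuous_const).inter
        ((isClosed_le continuous_const Complex.continuous_re).inter
          (isClosed_le Complex.continuous_re continuous_const))
    · rintro z ⟨h0, h1, h2⟩
      have := countMeas_one_div_succ_anti hjk
      exact ⟨h0, by linarith, by linarith⟩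
    · constructor
      · rintro ⟨h0, h1, h2⟩
        obtain ⟨j, hj⟩ := exists_nat_one_div_lt (lt_min (sub_pos.mpr h1) (sub_pos.mpr h2))
        have hj1 := hj.trans_le (min_le_left _ _)
        have hj2 := hj.trans_le (min_le_right _ _)
        exact ⟨j, h0, by linarith, by linarith⟩
      · rintro ⟨j, h0, h1, h2⟩
        have : (0 : ℝ) < 1 / (j + 1) := by positivity
        exact ⟨h0, by linarith, by linarith⟩

end Summit.QuantumFields.QCD.Cruxes.TipPricing.HermitianFlowCoarea

end
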